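import Mathlib
import Summits.ValiantsHypothesis.ValiantsHypothesis.Theorems.NewtonUnitEquationsNewtonTauWeakRefineDissociate

/-!
# `NewtonUnitEquationsNewtonTauWeakSignLevelSetOfT2All` — the sign-design kill switch needs no dissociation

Registered stub `stub_signLevelSetOfT2All` of line `binomial-normal-form` (crux `NewtonTauWeak`,
stmt-ValiantsHypothesis-5904, lead c7, namespace `RungC7b` of `Cruxes/NewtonTauWeak/Lines/binomial_normal_form.lean`,
wave 2, stub P2).

Setting.  `N` items with `𝔽₂^r`-valued weights `g j : Fin r → ZMod 2` and exponents `d j ∈ ℕ²` (coinciding subset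
sums allowed), a target `v : Fin r → ZMod 2`; the level set is `X_v(d) = {Σ_{j∈J} d j : Σ_{j∈J} g j = v} ⊆ ℕ²`
(embedded in `ℝ²` by `e ↦ (i ↦ (e i : ℝ))`).

Claim.  If the hull-vertex bound `#ext conv X_v(d) ≤ (2^r N + 2)^b` holds for every DISSOCIATED exponent list `d`
(all `2^N` subset sums distinct; this is stub P1, taken as the hypothesis `hP1`), then it holds for every `d`.

Proof.  Verbatim the proof of `stub_refineDissociate` with the `𝔽₂^r` filter predicate: the refinement
`d' j = (M₁ + 2^N) • d j + (2^j, 0)` is dissociated (`RefineDissociateAux.smul_add_single_injOn`, binary tags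
`Σ_{j∈J} 2^j < 2^N` injective in `J`, `RefineDissociateAux.sum_two_pow_lt` / `sum_two_pow_injective`), its level
set has at least as many hull vertices as that of `d` (`RefineDissociateAux.exists_scale_ncard_le` applied to the
finite family `F = {J : Σ_J g = v}`, `a J = Σ_J d`, `t J = Σ_{j∈J} 2^j`), and `hP1` bounds the latter.

Everything is folklore; no named facts, no citations, no `def`s.
-/

-- Sub = Summit single-conjunct layout: the duplicated namespace component is mandated by the tree.
set_option linter.dupNamespace false

noncomputable section

open scoped BigOperators

namespace Summit.ValiantsHypothesis.ValiantsHypothesis.Theorems.NewtonUnitEquationsNewtonTauWeak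

/-- **Stub P2 of line `binomial-normal-form` (RungC7b): the sign-design kill switch without dissociation.**  If for
every DISSOCIATED exponent list `d : Fin N → ℕ²` the `𝔽₂^r` level set `{Σ_J d : Σ_{j∈J} g j = v}` has at most
`(2^r N + 2)^b` hull vertices, then the same bound holds for every exponent list: refine `d` to the dissociated list
`d' j = (M₁ + 2^N) • d j + (2^j, 0)` without losing hull vertices (`RefineDissociateAux.exists_scale_ncard_le`,
`RefineDissociateAux.smul_add_single_injOn`) and apply the hypothesis to `d'`. [folklore] -/
theorem stub_signLevelSetOfT2All (b : ℕ)
    (hP1 : ∀ (N r : ℕ) (g : Fin N → Fin r → ZMod 2) (v : Fin r → ZMod 2) (d : Fin N → (Fin 2 →₀ ℕ)),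
      (∀ J J' : Finset (Fin N), ∑ j ∈ J, d j = ∑ j ∈ J', d j → J = J') →
      (Set.extremePoints ℝ (convexHull ℝ ((fun e : Fin 2 →₀ ℕ => fun i : Fin 2 => ((e i : ℕ) : ℝ)) ''
        (((Finset.univ.filter fun J : Finset (Fin N) => ∑ j ∈ J, g j = v).image
          fun J => ∑ j ∈ J, d j : Finset (Fin 2 →₀ ℕ)) : Set (Fin 2 →₀ ℕ))))).ncard ≤
        (2 ^ r * N + 2) ^ b)
    (N r : ℕ) (g : Fin N → Fin r → ZMod 2) (v : Fin r → ZMod 2) (d : Fin N → (Fin 2 →₀ ℕ)) :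
    (Set.extremePoints ℝ (convexHull ℝ ((fun e : Fin 2 →₀ ℕ => fun i : Fin 2 => ((e i : ℕ) : ℝ)) ''
      (((Finset.univ.filter fun J : Finset (Fin N) => ∑ j ∈ J, g j = v).image
        fun J => ∑ j ∈ J, d j : Finset (Fin 2 →₀ ℕ)) : Set (Fin 2 →₀ ℕ))))).ncard ≤
      (2 ^ r * N + 2) ^ b := by
  classical
  obtain ⟨M₁, hM₁⟩ := RefineDissociateAux.exists_scale_ncard_le
    (Finset.univ.filter fun J : Finset (Fin N) => ∑ j ∈ J, g j = v) (fun J => ∑ j ∈ J, d j)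
    (fun J => ∑ j ∈ J, 2 ^ (j : ℕ)) (2 ^ N) (fun J _ => (RefineDissociateAux.sum_two_pow_lt J).le)
    (RefineDissociateAux.sum_two_pow_injective N).injOn
  have hsum : ∀ J : Finset (Fin N), ∑ j ∈ J, ((M₁ + 2 ^ N) • d j + Finsupp.single 0 (2 ^ (j : ℕ))) =
      (M₁ + 2 ^ N) • ∑ j ∈ J, d j + Finsupp.single 0 (∑ j ∈ J, 2 ^ (j : ℕ)) := fun J => by
    rw [Finset.sum_add_distrib, Finset.smul_sum, Finsupp.single_finsetSum]
  have hdis' : ∀ J J' : Finset (Fin N),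
      ∑ j ∈ J, ((M₁ + 2 ^ N) • d j + Finsupp.single 0 (2 ^ (j : ℕ))) =
        ∑ j ∈ J', ((M₁ + 2 ^ N) • d j + Finsupp.single 0 (2 ^ (j : ℕ))) → J = J' := fun J J' h => by
    rw [hsum, hsum] at h
    exact RefineDissociateAux.smul_add_single_injOn Set.univ (fun J => ∑ j ∈ J, d j)
      (fun J => ∑ j ∈ J, 2 ^ (j : ℕ)) (M₁ + 2 ^ N)
      (fun J _ => (RefineDissociateAux.sum_two_pow_lt J).trans_le le_add_self)
      (RefineDissociateAux.sum_two_pow_injective N).injOn (Set.mem_univ J) (Set.mem_univ J') h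
  have hb := hP1 N r g v (fun j => (M₁ + 2 ^ N) • d j + Finsupp.single 0 (2 ^ (j : ℕ))) hdis'
  simp only [hsum] at hb
  exact (hM₁ _ le_self_add).trans hb

end Summit.ValiantsHypothesis.ValiantsHypothesis.Theorems.NewtonUnitEquationsNewtonTauWeak

end
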